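import Literature.AlgebraicGeometry.Frobenioids.ArchimedeanProp35iiCounterexampleAngular
import Literature.AlgebraicGeometry.Frobenioids.ArchimedeanIsotropicAnchors
import HarnessLib

/-!
# Frobenioids II, Proposition 3.5 (iv) for `C` as typed (`ArchFrd.Prop35iv_C`, FACT-LIST F-0866): a
# COUNTEREXAMPLE over a CONNECTED base — over the toy base `T` the archimedean Frobenioid `C` IS of
# RC-iso-subanchor type

Mochizuki, *The geometry of Frobenioids II: poly-Frobenioids*, Kyushu J. Math. **62** (2008) 401–460,
§3, Proposition 3.5 (iv), kurims p. 34 [cite: MochizukiFrdII2008, Prop 3.5 (iv) p.34]: "`F` is not of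
RC-iso-subanchor type" (`F = C, A` over a CONNECTED, TOTALLY EPIMORPHIC base `D → D₀` of RC-iso-subanchor
type, Ex. 3.3 (i) p. 28; RC-notions [FrdII] Def. 3.1 (v) p. 25 [cite: MochizukiFrdII2008, Def 3.1 (v) p.25];
anchors / mono-minimal quotients [FrdI] §0 p. 18 [cite: MochizukiFrdI2008, §0 p.18]).

IN THE TREE the typed instance `ArchFrd.Prop35iv_C π` is PROVED for `D` connected and totally epimorphic
(`ArchFrd.prop35iv_C`, abc-iut-L1) — indeed for `D` nonempty with invertible split monomorphisms
(`ArchFrd.prop35iv_C_of_splitMono`, `ArchimedeanProp35ivSplitMono.lean`) — and its universal closure is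
refuted at the EMPTY base (`ArchFrd.not_forall_prop35iv_C`, abc-iut-f-007, where `C = ∅` is vacuously of
RC-iso-subanchor type). PROVED HERE (seat abc-iut-f-014, block F; proof-only): the closure already fails
over the CONNECTED three-object base `T → D₀` of `ArchimedeanProp35iiToyBase(RC).lean` (finite `ℤ/2`-sets
`c = ℤ/2`, `p = pt`, `e = pt ⊔ pt`, constant functor at `Spec ℂ`; of RC-iso-subanchor type; NOT totally
epimorphic — `p → e` is a non-invertible split monomorphism), i.e. connectedness is not what (iv) needs:

* `complexObjects_C` — every object of `C_T` is complex; `not_isIrreducibleHom_complexPart_over_p` /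
  `isRCAnchor_over_p` — every object `(X₀, p, ι)` over the point is an RC-ANCHOR of `C` (no arrow of
  `C[ℂ]` out of it is irreducible: `(φ₀, g) = (1, p → e) ≫ (φ₀, e → p ≫ g)` with neither factor
  invertible), so every object is an RC-subanchor (`isRCSubanchor_C`, via `(1, x → p)`);
* `exists_isMonoMinimalQuotient_over_p` — `(1, c → p) : (X₀, c, ι) → (X₀, p, ι)` is a mono-minimal
  categorical quotient by `{γ | γ_{C₀} = 1} ∋ (1, σ)`; `isMonoMinimalQuotient_bot_id_over_c/_e` — the
  identities of objects over `c`, `e` are mono-minimal quotients by the trivial group (a factorisation of an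
  identity through a monomorphism is pinned by the shapes of arrows of `T`; `C₀`-parts are split
  monomorphisms of the totally epimorphic `C₀`, `C0.isTotallyEpimorphic`);
* **`isOfRCIsoSubanchorType_C`** — `C_T` IS of RC-iso-subanchor type; hence **`not_prop35iv_C`**,
  **`not_forall_prop35iv_C_of_isGraphConnected`** (`¬ ∀ D π, IsGraphConnected D → Prop35iv_C π`),
  `exists_connected_base_not_prop35iv_C`.

READING. A statement about OUR typed row (the schema omits «totally epimorphic»); print is unaffected. With
`ArchimedeanProp35ivSplitMono.lean`: the typed (iv) holds over every nonempty base whose split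
monomorphisms are invertible and fails over a connected base with one non-invertible split monomorphism.
The twin for the angular Frobenioid `A` is the sequel file. Nothing here bears on [IUTchIII] Cor. 3.12.
-/

namespace Literature.AlgebraicGeometry.Frobenioids

open CategoryTheory

noncomputable section

namespace ArchFrd

namespace P35iiToy

/-! ### Objects and arrows of `C_T = C₀ ×_{D₀} T` with prescribed `C₀`-part -/

/-- Every object of `C_T` is complex for `C → T → D₀ → ArchBase` (the base functor is constant at `Spec ℂ`).
[cite: MochizukiFrdII2008, Def 3.1 (v) p.24] -/
theorem complexObjects_C (X : C toD0) : RC.complexObjects (rcOf toD0) X :=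
  (D0.isComplex_toArchBase_iff _).mpr rfl

/-- Over the constant base functor, the arrow `(1, g) : (X₀, x, ι) → (X₀, y, ι)` is compatible for every
arrow `g` of `T`. [cite: MochizukiFrdII2008, Ex 3.3 (i) p.28] -/
theorem w_id (X₀ : C0) (ι : (PreFrobenioid.baseFunctor C0.toElem).obj X₀ ≅ D0.complex) {x y : T} (g : x ⟶ y) :
    (PreFrobenioid.baseFunctor C0.toElem).map (𝟙 X₀) ≫ ι.hom = ι.hom ≫ toD0.map g := by
  rw [CategoryTheory.Functor.map_id, Category.id_comp]
  exact (Category.comp_id _).symm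

/-! ### Objects over the point are RC-anchors -/

/-- **No arrow of `C[ℂ]` out of an object over `p` is irreducible**: `(φ₀, g) = (1, p → e) ≫ (φ₀, e → p ≫ g)`
with neither factor invertible. [cite: MochizukiFrdI2008, §0 p.18] -/
theorem not_isIrreducibleHom_complexPart_over_p (X₀ : C0)
    (ι : (PreFrobenioid.baseFunctor C0.toElem).obj X₀ ≅ D0.complex) {Y : RC.ComplexPart (rcOf toD0)}
    (φ : (⟨⟨X₀, T.p, ι⟩, complexObjects_C _⟩ : RC.ComplexPart (rcOf toD0)) ⟶ Y) : ¬ IsIrreducibleHom φ := by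
  intro hφ
  obtain ⟨⟨Y₀, y, ιY⟩, hY⟩ := Y
  let M : RC.ComplexPart (rcOf toD0) := ⟨⟨X₀, T.e, ι⟩, complexObjects_C _⟩
  let β : (⟨⟨X₀, T.p, ι⟩, complexObjects_C _⟩ : RC.ComplexPart (rcOf toD0)) ⟶ M :=
    ObjectProperty.homMk ⟨𝟙 X₀, T.sec false, w_id X₀ ι _⟩
  let α : M ⟶ ⟨⟨Y₀, y, ιY⟩, hY⟩ := ObjectProperty.homMk ⟨φ.hom.fst, T.ret ≫ φ.hom.snd, φ.hom.w⟩
  have hfac : β ≫ α = φ := by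
    apply ObjectProperty.hom_ext
    change (⟨𝟙 X₀, T.sec false, w_id X₀ ι _⟩ : (⟨X₀, T.p, ι⟩ : C toD0) ⟶ ⟨X₀, T.e, ι⟩) ≫
        (⟨φ.hom.fst, T.ret ≫ φ.hom.snd, φ.hom.w⟩ : (⟨X₀, T.e, ι⟩ : C toD0) ⟶ ⟨Y₀, y, ιY⟩) = φ.hom
    refine CFP.hom_ext (Category.id_comp _) ?_
    change T.sec false ≫ T.ret ≫ φ.hom.snd = φ.hom.snd
    rw [← Category.assoc, T.sec_comp_ret, Category.id_comp]
  rcases hφ.2 β α hfac with hα | hβ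
  · haveI := hα
    have hs : IsIso (T.ret ≫ φ.hom.snd) := CFP.isIso_snd α.hom
    cases y with
    | c => exact (T.isEmpty_hom_pc.false φ.hom.snd).elim
    | p =>
      rw [Subsingleton.elim (T.ret ≫ φ.hom.snd) T.ret] at hs
      exact T.not_isIso_ret hs
    | e =>
      obtain ⟨i, hi⟩ := T.hom_pe_eq φ.hom.snd
      rw [hi, T.ret_comp_sec] at hs
      exact T.not_isIso_emap_const i hs
  · haveI := hβ
    exact T.not_isIso_sec false (CFP.isIso_snd β.hom)

/-- **Every object of `C_T` over the point is an RC-ANCHOR** (complex, and vacuously an anchor of `C[ℂ]`).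
[cite: MochizukiFrdII2008, Def 3.1 (v) p.25] -/
theorem isRCAnchor_over_p (X₀ : C0) (ι : (PreFrobenioid.baseFunctor C0.toElem).obj X₀ ≅ D0.complex) :
    RC.IsRCAnchor (rcOf toD0) (⟨X₀, T.p, ι⟩ : C toD0) := by
  refine ⟨complexObjects_C _, Set.Finite.subset Set.finite_empty ?_⟩
  rintro x ⟨f, hf, -⟩
  exact (not_isIrreducibleHom_complexPart_over_p X₀ ι f.hom hf).elim

/-- **Every object of `C_T` is an RC-subanchor**: `(1, x → p)` maps it to the RC-anchor `(X₀, p, ι)`.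
[cite: MochizukiFrdII2008, Def 3.1 (v) p.25] -/
theorem isRCSubanchor_C (X : C toD0) : RC.IsRCSubanchor (rcOf toD0) X := by
  obtain ⟨X₀, x, ι⟩ := X
  refine ⟨⟨X₀, T.p, ι⟩, isRCAnchor_over_p X₀ ι, ?_⟩
  cases x with
  | c => exact ⟨⟨𝟙 X₀, T.quot, w_id X₀ ι _⟩⟩
  | p => exact ⟨⟨𝟙 X₀, 𝟙 T.p, w_id X₀ ι _⟩⟩
  | e => exact ⟨⟨𝟙 X₀, T.ret, w_id X₀ ι _⟩⟩

/-! ### Mono-minimal categorical quotient presentations of the objects of `C_T` -/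

/-- **`(1, c → p) : (X₀, c, ι) → (X₀, p, ι)` is a MONO-MINIMAL CATEGORICAL QUOTIENT by
`G = {γ | γ_{C₀} = 1} ∋ (1, σ)`** (the `T`-part of a `G`-invariant arrow is `σ`-invariant, hence lands over
`p` or `e` and factors uniquely through `c → p`; a monomorphism out of `(X₀, c, ι)` through which the
quotient factors lies over `c`, and then its `C₀`-part is a split monomorphism of the totally epimorphic
`C₀`). [cite: MochizukiFrdI2008, §0 p.18] -/
theorem exists_isMonoMinimalQuotient_over_p (X₀ : C0)
    (ι : (PreFrobenioid.baseFunctor C0.toElem).obj X₀ ≅ D0.complex) :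
    ∃ G : Subgroup (Aut (⟨X₀, T.c, ι⟩ : C toD0)),
      IsMonoMinimalQuotient G (⟨𝟙 X₀, T.quot, w_id X₀ ι _⟩ : (⟨X₀, T.c, ι⟩ : C toD0) ⟶ ⟨X₀, T.p, ι⟩) := by
  let σ : (⟨X₀, T.c, ι⟩ : C toD0) ≅ ⟨X₀, T.c, ι⟩ := CFP.isoMk (Iso.refl X₀) T.swIso (w_id X₀ ι T.sw)
  have hσfst : σ.hom.fst = 𝟙 X₀ := rfl
  have hσsnd : σ.hom.snd = T.sw := rfl
  have hσne : σ.hom ≠ 𝟙 _ := fun h => T.sw_ne_id (hσsnd ▸ congrArg CFP.Hom.snd h)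
  refine ⟨{ carrier := {γ | γ.hom.fst = 𝟙 _}
            one_mem' := rfl
            mul_mem' := fun {γ δ} hγ hδ => ?_
            inv_mem' := fun {γ} hγ => ?_ }, ⟨fun γ hγ => ?_, fun X ψ hψ => ?_⟩,
          fun A' ζ φ' hfac hmono _ => ?_⟩
  · change (δ.hom ≫ γ.hom).fst = 𝟙 _
    rw [CFP.comp_fst, show γ.hom.fst = 𝟙 _ from hγ, show δ.hom.fst = 𝟙 _ from hδ, Category.comp_id]
  · change γ.inv.fst = 𝟙 _
    have h : (γ.hom ≫ γ.inv).fst = 𝟙 _ := by rw [γ.hom_inv_id]; rfl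
    rwa [CFP.comp_fst, show γ.hom.fst = 𝟙 _ from hγ, Category.id_comp] at h
  · refine CFP.hom_ext ?_ (Subsingleton.elim _ _)
    rw [CFP.comp_fst, show γ.hom.fst = 𝟙 _ from hγ, Category.id_comp]
  · have hsw : T.sw ≫ ψ.snd = ψ.snd := congrArg CFP.Hom.snd (hψ σ hσfst)
    have hfst : ∀ ψ' : (⟨X₀, T.p, ι⟩ : C toD0) ⟶ X,
        (⟨𝟙 X₀, T.quot, w_id X₀ ι _⟩ : (⟨X₀, T.c, ι⟩ : C toD0) ⟶ ⟨X₀, T.p, ι⟩) ≫ ψ' = ψ →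
          ψ'.fst = ψ.fst := fun ψ' h => by
      have h1 := congrArg CFP.Hom.fst h
      rwa [CFP.comp_fst, Category.id_comp] at h1
    obtain ⟨Y₀, y, ιY⟩ := X
    cases y with
    | c => exact (T.sw_comp_ne_self ψ.snd hsw).elim
    | p =>
      exact ⟨⟨ψ.fst, 𝟙 _, ψ.w⟩, CFP.hom_ext (Category.id_comp _) (Subsingleton.elim _ _),
        fun ψ' hψ' => CFP.hom_ext (hfst ψ' hψ') (Subsingleton.elim _ _)⟩
    | e =>
      obtain ⟨i, hi⟩ := T.hom_ce_eq ψ.snd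
      refine ⟨⟨ψ.fst, T.sec i, ψ.w⟩, CFP.hom_ext (Category.id_comp _) ?_, fun ψ' hψ' => ?_⟩
      · change T.quot ≫ T.sec i = ψ.snd
        rw [T.quot_comp_sec, hi]
      · refine CFP.hom_ext (hfst ψ' hψ') ?_
        obtain ⟨j, hj⟩ := T.hom_pe_eq ψ'.snd
        have h2 := congrArg CFP.Hom.snd hψ'
        change T.quot ≫ ψ'.snd = ψ.snd at h2
        rw [hj, T.quot_comp_sec, hi] at h2
        change ψ'.snd = T.sec i
        rw [hj, T.cst_injective h2]
  · obtain ⟨A₀, a, ιA⟩ := A'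
    have hσζ : σ.hom ≫ ζ = 𝟙 _ ≫ ζ → False := fun h => hσne ((cancel_mono ζ).mp h)
    have hfstζ : (σ.hom ≫ ζ).fst = (𝟙 (⟨X₀, T.c, ι⟩ : C toD0) ≫ ζ).fst := by
      rw [CFP.comp_fst, CFP.comp_fst, hσfst, CFP.id_fst]
    cases a with
    | c =>
      haveI : IsIso ζ.snd := T.isIso_hom_cc ζ.snd
      have h1 : ζ.fst ≫ φ'.fst = 𝟙 _ := congrArg CFP.Hom.fst hfac
      haveI : IsSplitMono ζ.fst := IsSplitMono.mk' ⟨φ'.fst, h1⟩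
      haveI : Epi ζ.fst := C0.isTotallyEpimorphic.epi ζ.fst
      haveI : IsIso ζ.fst := isIso_of_epi_of_isSplitMono ζ.fst
      exact CFP.isIso_of_isIso_fst_snd ζ
    | p => exact (hσζ (CFP.hom_ext hfstζ (Subsingleton.elim _ _))).elim
    | e =>
      refine (hσζ (CFP.hom_ext hfstζ ?_)).elim
      obtain ⟨i, hi⟩ := T.hom_ce_eq ζ.snd
      change T.sw ≫ ζ.snd = 𝟙 T.c ≫ ζ.snd
      rw [hi, T.sw_comp_cst, Category.id_comp]

/-- **The identity of an object over `c` is a mono-minimal categorical quotient by the trivial group**: a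
factorisation `(X₀, c, ι) → A' → (X₀, c, ι)` of the identity has `A'` over `c`, invertible `T`-part and
split-monomorphic, hence invertible, `C₀`-part. [cite: MochizukiFrdI2008, §0 p.18] -/
theorem isMonoMinimalQuotient_bot_id_over_c (X₀ : C0)
    (ι : (PreFrobenioid.baseFunctor C0.toElem).obj X₀ ≅ D0.complex) :
    IsMonoMinimalQuotient (⊥ : Subgroup (Aut (⟨X₀, T.c, ι⟩ : C toD0))) (𝟙 _) := by
  refine ⟨⟨fun γ hγ => ?_, fun X ψ _ => ⟨ψ, Category.id_comp ψ, fun ψ' hψ' => ?_⟩⟩,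
    fun A' ζ φ' hfac _ _ => ?_⟩
  · rw [Subgroup.mem_bot] at hγ
    subst hγ
    exact Category.id_comp _
  · rw [← hψ', Category.id_comp]
  · obtain ⟨A₀, a, ιA⟩ := A'
    cases a with
    | c =>
      haveI : IsIso ζ.snd := T.isIso_hom_cc ζ.snd
      have h1 : ζ.fst ≫ φ'.fst = 𝟙 _ := congrArg CFP.Hom.fst hfac
      haveI : IsSplitMono ζ.fst := IsSplitMono.mk' ⟨φ'.fst, h1⟩
      haveI : Epi ζ.fst := C0.isTotallyEpimorphic.epi ζ.fst
      haveI : IsIso ζ.fst := isIso_of_epi_of_isSplitMono ζ.fst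
      exact CFP.isIso_of_isIso_fst_snd ζ
    | p => exact (T.isEmpty_hom_pc.false φ'.snd).elim
    | e => exact (T.isEmpty_hom_ec.false φ'.snd).elim

/-- **The identity of an object over `e` is a mono-minimal categorical quotient by the trivial group**: a
factorisation of the identity through `A'` over `p` would make `e → p → e` the identity; over `e` the
`T`-part has a left inverse, hence is invertible, and the `C₀`-part is a split monomorphism.
[cite: MochizukiFrdI2008, §0 p.18] -/
theorem isMonoMinimalQuotient_bot_id_over_e (X₀ : C0)
    (ι : (PreFrobenioid.baseFunctor C0.toElem).obj X₀ ≅ D0.complex) :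
    IsMonoMinimalQuotient (⊥ : Subgroup (Aut (⟨X₀, T.e, ι⟩ : C toD0))) (𝟙 _) := by
  refine ⟨⟨fun γ hγ => ?_, fun X ψ _ => ⟨ψ, Category.id_comp ψ, fun ψ' hψ' => ?_⟩⟩,
    fun A' ζ φ' hfac _ _ => ?_⟩
  · rw [Subgroup.mem_bot] at hγ
    subst hγ
    exact Category.id_comp _
  · rw [← hψ', Category.id_comp]
  · obtain ⟨A₀, a, ιA⟩ := A'
    have hsnd : ζ.snd ≫ φ'.snd = 𝟙 T.e := congrArg CFP.Hom.snd hfac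
    have h1 : ζ.fst ≫ φ'.fst = 𝟙 _ := congrArg CFP.Hom.fst hfac
    haveI : IsSplitMono ζ.fst := IsSplitMono.mk' ⟨φ'.fst, h1⟩
    haveI : Epi ζ.fst := C0.isTotallyEpimorphic.epi ζ.fst
    haveI : IsIso ζ.fst := isIso_of_epi_of_isSplitMono ζ.fst
    cases a with
    | c => exact (T.isEmpty_hom_ec.false ζ.snd).elim
    | p =>
      exfalso
      obtain ⟨i, hi⟩ := T.hom_pe_eq φ'.snd
      rw [Subsingleton.elim ζ.snd T.ret, hi, T.ret_comp_sec, T.id_e] at hsnd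
      exact T.const_ne_id i (T.emap_injective hsnd)
    | e =>
      obtain ⟨g, hg⟩ := T.hom_ee_eq ζ.snd
      obtain ⟨g', hg'⟩ := T.hom_ee_eq φ'.snd
      rw [hg, hg'] at hsnd
      haveI : IsIso ζ.snd := hg ▸ T.isIso_emap_of_comp_eq_id hsnd
      exact CFP.isIso_of_isIso_fst_snd ζ

/-! ### `C_T` is of RC-iso-subanchor type; the refutation -/

/-- **`C_T` IS OF RC-ISO-SUBANCHOR TYPE** (over the connected, non-totally-epimorphic base `T → D₀`).
[cite: MochizukiFrdII2008, Prop 3.5 (iv) p.34] -/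
theorem isOfRCIsoSubanchorType_C : RC.IsOfRCIsoSubanchorType (rcOf toD0) := by
  refine ⟨fun X => ?_⟩
  obtain ⟨X₀, x, ι⟩ := X
  cases x with
  | c => exact ⟨_, ⊥, 𝟙 _, isRCSubanchor_C _, isMonoMinimalQuotient_bot_id_over_c X₀ ι⟩
  | p =>
    obtain ⟨G, hG⟩ := exists_isMonoMinimalQuotient_over_p X₀ ι
    exact ⟨⟨X₀, T.c, ι⟩, G, _, isRCSubanchor_C _, hG⟩
  | e => exact ⟨_, ⊥, 𝟙 _, isRCSubanchor_C _, isMonoMinimalQuotient_bot_id_over_e X₀ ι⟩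

/-- **[FrdII] Prop. 3.5 (iv) as typed FAILS for `C` over the connected toy base**: `T` is of
RC-iso-subanchor type and so is `C_T`. [cite: MochizukiFrdII2008, Prop 3.5 (iv) p.34] -/
theorem not_prop35iv_C : ¬ Literature.AlgebraicGeometry.Frobenioids.ArchFrd.Prop35iv_C toD0 := fun h =>
  h isOfRCIsoSubanchorType_toD0 isOfRCIsoSubanchorType_C

/-- **Connectedness of the base is not enough for the typed Prop. 3.5 (iv)** (FACT-LIST F-0866; sharper
than the empty-base refutation `ArchFrd.not_forall_prop35iv_C`). [cite: MochizukiFrdII2008, Prop 3.5 (iv) p.34] -/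
theorem not_forall_prop35iv_C_of_isGraphConnected :
    ¬ ∀ (D : Type) [Category.{0} D] (π : D ⥤ D0), IsGraphConnected D →
      Literature.AlgebraicGeometry.Frobenioids.ArchFrd.Prop35iv_C π :=
  fun h => not_prop35iv_C (h T toD0 T.isGraphConnected)

/-- **Packaged witness for `C`**: a connected base of RC-iso-subanchor type, NOT totally epimorphic, over
which `C` IS of RC-iso-subanchor type (so the typed (iv) fails). [cite: MochizukiFrdII2008, Prop 3.5 (iv) p.34] -/
theorem exists_connected_base_not_prop35iv_C :
    ∃ (D : Type) (_ : Category.{0} D) (π : D ⥤ D0), IsGraphConnected D ∧ ¬ IsTotallyEpimorphic D ∧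
      RC.IsOfRCIsoSubanchorType (baseRC π) ∧ RC.IsOfRCIsoSubanchorType (rcOf π) ∧
        ¬ Literature.AlgebraicGeometry.Frobenioids.ArchFrd.Prop35iv_C π :=
  ⟨T, inferInstance, toD0, T.isGraphConnected, T.not_isTotallyEpimorphic, isOfRCIsoSubanchorType_toD0,
    isOfRCIsoSubanchorType_C, not_prop35iv_C⟩

end P35iiToy

end ArchFrd

end

end Literature.AlgebraicGeometry.Frobenioids
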